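import Literature.MathematicalPhysics.QuantumFieldTheory.Balaban1983to89.B4ThmBoxPairEta
import Literature.MathematicalPhysics.QuantumFieldTheory.Balaban1983to89.B4Thm112BoxNoCollar

/-!
# `Balaban1983to89.B4ThmBoxPairEtaNoCollar` — [Balaban1983RegularityDecay] THEOREM p. 573, (1.9)–(1.12), ON THE
# FAMILY OF NESTED PAIRS OF BOXES `Ω ⊂ Ω₀` AT A (1.7)-REGULAR FIELD, TYPED FORM `ThmPrintedNN` — WITHOUT THE COLLAR
# HYPOTHESIS

statement-level skeleton of published theorems with citation tags; proofs where landed; nothing here is a claim about the Yang–Mills mass gap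

CITATION HEADER.  T. Bałaban, *Regularity and decay of lattice Green's functions*, Commun. Math. Phys. **89** (1983)
571–597, doi:10.1007/bf01214744 [Balaban1983RegularityDecay] (cell paper B4; held text
`paper:balaban1983-cmp89-regularity-decay`, journal page = PDF page + 570; p. 572 (1.7), p. 573 Theorem (1.9)–(1.12)).
Unit `lit-balaban-r04` gen 15 (HOME `run/shared/lean/pub/lit-balaban/`), SKELETON row **B4.Thm@573**; last step of
the collar-drop programme of HOME/GAPS.md G-B4-p17-02 (owner r01, ruling 2026-08-22).

Honest framing.  `B4ThmBoxPairEta.thmPrintedNN_boxPairFam` (p17 g5) inhabits pv17's typed form `ThmPrintedNN` of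
the printed Theorem on the family of nested pairs of boxes, with the side condition `regular` := (1.7) on `Ω₀` AND
«`A_c` constant on the `K`-collars of `Ω₀` and of `Ω`» — a technical hypothesis NOT in the print (G-B4-p17-02).  This
module removes it: `boxPairFamNC` is the same family with `regular` := (1.7) on `Ω₀` ONLY, and
**`thmPrintedNN_boxPairFamNC : ThmPrintedNN (boxPairFamNC …)`**.  The proof is p17's assembly VERBATIM, fed by the
collar-free members `B4Thm110BoxNoCollar.thm110_value_box_noCollar` / `thm110_deriv_box_noCollar`,
`B4Thm19BoxNoCollar.thm19_holder_box_noCollar_all`, `B4Thm112BoxNoCollar.thm112_value_box_noCollar` /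
`thm112_deriv_box_noCollar` / `thm112_holder_box_noCollar` (which rest on the face-bound Lemma 2.2 of
`B4Lemma22BoxNoCollar` / `B4Lemma22HolderNoCollar`: Neumann gauge of `B4BoxNeumannGauge` + gauge covariance
instead of «A′ = 0 on the face-touching bonds»).  The instances `BoxPairInst` and all setting fields other than
`regular` are those of `B4ThmBoxPairEta` (reused, not re-declared).

WHAT THIS MODULE PROVES (all in full).
* §1 `box_pair_members_noCollar` — the six members packaged with ONE `K` (product of the members' `K`'s, before
  `α`) and ONE constant, for every (1.7)-regular `A_c` on `Ω₀` (no collar clause).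
* §2 `boxPairFamNC := { boxPairFam … with regular := (1.7) on Ω₀ }` (a one-field structure update of p17's family),
  `regular_of_boxPairFam_regular` (collared ⇒ collar-free: every instance p17's theorem covers is covered),
  `boxPairFamNC_bigBlocks` (`rfl`), `KmodNC`, `hypotheses_met_noCollar` (non-vacuity).
* §3 **`thmPrintedNN_boxPairFamNC : ThmPrintedNN (boxPairFamNC F d ℓ a₋ a₊ m²₊ c β K)`** with `K = KmodNC`:
  `∀ α ∈ [0,1) ∃ δ₀ c₀ R₀ e₁ > 0 ∀ i, regular → bigBlocks → 0 < e ≤ e₁ → Ineq19_110 ∧ Ineq111_112` (`δ₀ = (2K)⁻¹`).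
HONEST SCOPE.  As the members: `d ≥ 1`; boxes (rectangular parallelepipeds, `rect = True`; the printed «Ω a sum of
big blocks» in general is NOT covered); the side condition `bigBlocks` = unit sides multiples of `K`; distances to
`Ω₀ ∖ Ω ⊆ Ω^c` in (1.12); norms of vectors in `ℝ^N` Euclidean (`siteNorm`), `‖f‖_∞ = supN`; `0 ≤ α < 1`.  The collar
clause of G-B4-p17-02 is GONE: `regular` is exactly (1.7) on `Ω₀` with the family's `(c, β)`.
No `sorry`; no new `Prop` fact; axioms standard.
v1.1 (unit `lit-balaban-r04` gen 20, DOCSTRING-ONLY; every declaration byte-identical with v1.0 p330032): the `[cite:]` tags of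
§2 `boxPairFamNC` / `regular_of_boxPairFam_regular` read "Theorem (1.7)–(1.12) p.573" / "Theorem (1.7) p.573"; (1.7) — the
regularity condition the field `regular` transcribes — is the last display of p. 572, the Theorem with (1.9)–(1.12) is
p. 573 (×2 renders `…/1983-cmp89-regularity-decay-p002-x2.png` / `-p003-x2.png`); corrected to "(1.7) p.572 with Theorem …
p.573" and p. 572 added to the citation header (summit-lit1 CITELOC register row P79-004).
-/

namespace Literature.MathematicalPhysics.QuantumFieldTheory.Balaban1983to89.B4ThmBoxPairEtaNoCollar

open Literature.MathematicalPhysics.QuantumFieldTheory.Balaban1983to89.B4 (EtaSetting Ineq19_110 Ineq111_112)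
open Literature.MathematicalPhysics.QuantumFieldTheory.Balaban1983to89.B4Ineq111ZeroNestEta (ThmPrintedNN)
open Literature.MathematicalPhysics.QuantumFieldTheory.Balaban1983to89.B4Reflection242 (boxDom mem_boxDom nbrs mem_nbrs)
open Literature.MathematicalPhysics.QuantumFieldTheory.Balaban1983to89.B4GaugeCovariance
open Literature.MathematicalPhysics.QuantumFieldTheory.Balaban1983to89.B4ContourShift (supNorm supNorm_nonneg)
open Literature.MathematicalPhysics.QuantumFieldTheory.Balaban1983to89.B4Lower18Regular (e1 baseEmb stairContour)
open Literature.MathematicalPhysics.QuantumFieldTheory.Balaban1983to89.B4Lower18RegularRegion (compField)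
open Literature.MathematicalPhysics.QuantumFieldTheory.Balaban1983to89.B4Lemma21Region (siteNorm
  fld_covDeriv_mulVec_of_not_mem)
open Literature.MathematicalPhysics.QuantumFieldTheory.Balaban1983to89.B4Lemma22ReduceZero (Box opA greenA derivA)
open Literature.MathematicalPhysics.QuantumFieldTheory.Balaban1983to89.B4Lemma22Reduce231 (supN le_supN supN_nonneg
  siteNorm_nonneg siteNorm_zero siteNorm_smul)
open Literature.MathematicalPhysics.QuantumFieldTheory.Balaban1983to89.B4Lemma22HolderBox (IsNNChain)
open Literature.MathematicalPhysics.QuantumFieldTheory.Balaban1983to89.B4SubBoxCarrier (subEmb inSub inSub_iff)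
open Literature.MathematicalPhysics.QuantumFieldTheory.Balaban1983to89.B4BoxCubeGeometry (posR)
open Literature.MathematicalPhysics.QuantumFieldTheory.Balaban1983to89.B4RegionCubeCarrier (compField_add)
open Literature.MathematicalPhysics.QuantumFieldTheory.Balaban1983to89.B4Thm112BoxIdentity (extV)
open Literature.MathematicalPhysics.QuantumFieldTheory.Balaban1983to89.B4Thm112BoxValue (exists_coord_of_le_supNorm
  siteNorm_le_sqrt_card_mul abs_apply_le_siteNorm')
open Literature.MathematicalPhysics.QuantumFieldTheory.Balaban1983to89.B4Thm112BoxDeriv (restrV restrV_apply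
  derivA_restrV_apply)
open Literature.MathematicalPhysics.QuantumFieldTheory.Balaban1983to89.B4ThmBoxPairEta (BoxPairInst boxPairFam)
open Literature.MathematicalPhysics.QuantumFieldTheory.Balaban1983to89.B4Thm110BoxNoCollar (thm110_value_box_noCollar
  thm110_deriv_box_noCollar)
open Literature.MathematicalPhysics.QuantumFieldTheory.Balaban1983to89.B4Thm19BoxNoCollar (thm19_holder_box_noCollar_all)
open Literature.MathematicalPhysics.QuantumFieldTheory.Balaban1983to89.B4Thm112BoxNoCollar (thm112_value_box_noCollar
  thm112_deriv_box_noCollar thm112_holder_box_noCollar)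
open scoped Matrix

noncomputable section

variable {ι : Type} [Fintype ι] [DecidableEq ι]

/-! ## §1. The six members with one `K` and one constant, no collar -/

/-- **THE SIX MEMBERS OF THE THEOREM ON A NESTED PAIR OF BOXES, NO COLLAR, PACKAGED**: (1.10) value and derivative and (1.9) on
`Ω` (field `A_c(· + n·o)`), and the three `δG` members with the factor (1.12), with ONE large-cube modulus `K` (the
product of the members') and ONE constant. [cite: Balaban1983RegularityDecay, Theorem (1.9)–(1.12) p.573] -/
theorem box_pair_members_noCollar (F : OrthFlow ι) {ℓ₁ : ℝ} (hℓ₁ : 0 ≤ ℓ₁)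
    (hLip : ∀ t (v : ι → ℝ), ((F.U t - 1) *ᵥ v) ⬝ᵥ ((F.U t - 1) *ᵥ v) ≤ (ℓ₁ * t) ^ 2 * (v ⬝ᵥ v))
    (d ℓ : ℕ) (hd : 1 ≤ d) (hℓ : 1 ≤ ℓ) (amin aplus m2plus : ℝ) (ha : 0 < amin) :
    ∃ K : ℕ, 16 ≤ K ∧ 4 ∣ K ∧ ∀ (α : ℝ), 0 ≤ α → α < 1 → ∃ C : ℝ, 0 < C ∧ ∀ (creg β : ℝ), 0 ≤ creg → 0 < β →
      ∃ e₁ : ℝ, 0 < e₁ ∧ ∀ (k : ℕ), 1 ≤ k → ∀ (hn : 1 ≤ (ℓ + 1) ^ k) (a m2 : ℝ),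
      amin ≤ a → a ≤ aplus → 0 ≤ m2 → m2 ≤ m2plus →
      ∀ (Mb Ms o : Fin (d + 1) → ℕ) (ho : ∀ i, o i + Ms i ≤ Mb i), (∀ i, 1 ≤ Ms i) → (∀ μ, K ∣ Mb μ) →
        (∀ μ, K ∣ Ms μ) →
      ∀ (Ac : (Fin (d + 1) → ℤ) → Fin (d + 1) → ℝ) (e : ℝ), 0 < e → e ≤ e₁ →
        (∀ x ∈ Box d ℓ k Mb, ∀ μ ν : Fin (d + 1),
          |Ac (x + e1 μ) ν - Ac x ν| ≤ creg * e ^ (β - 1) / ((ℓ + 1) ^ k : ℕ)) →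
      -- (1.10), value, on `Ω`
      (∀ (x : ↥(Box d ℓ k Ms)) (P : ↥(Box d ℓ k Ms) → Prop) [DecidablePred P] (D : ℝ), 0 ≤ D →
        (∀ x', P x' → ∃ μ, D ≤ |posR ℓ k Ms x μ - posR ℓ k Ms x' μ|) →
        ∀ (f : ↥(Box d ℓ k Ms) × ι → ℝ), (∀ p, ¬ P p.1 → f p = 0) → ∀ (φ : ℝ), 0 ≤ φ → (∀ p, |f p| ≤ φ) →
        ∀ i : ι,
          |(greenA d F (e / ((ℓ + 1) ^ k : ℕ)) ℓ k a m2 Ms (baseEmb hn Ms) (stairContour hn Ms)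
              (fun u v : ↥(Box d ℓ k Ms) =>
                compField (fun w => Ac (w + fun i => (((ℓ + 1) ^ k : ℕ) : ℤ) * (o i : ℤ))) u.1 v.1) *ᵥ f) (x, i)|
            ≤ C * Real.exp (-(D / K)) * φ) ∧
      -- (1.10), derivative, on `Ω`
      (∀ (ν : Fin (d + 1)) (x : ↥(Box d ℓ k Ms)), x.1 + e1 ν ∈ Box d ℓ k Ms →
        ∀ (P : ↥(Box d ℓ k Ms) → Prop) [DecidablePred P] (D : ℝ), 0 ≤ D →
        (∀ x', P x' → ∃ μ, D ≤ |posR ℓ k Ms x μ - posR ℓ k Ms x' μ|) →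
        ∀ (f : ↥(Box d ℓ k Ms) × ι → ℝ), (∀ p, ¬ P p.1 → f p = 0) → ∀ (φ : ℝ), 0 ≤ φ → (∀ p, |f p| ≤ φ) →
        ∀ i : ι,
          |(derivA d F (e / ((ℓ + 1) ^ k : ℕ)) ℓ k Ms
              (fun u v : ↥(Box d ℓ k Ms) =>
                compField (fun w => Ac (w + fun i => (((ℓ + 1) ^ k : ℕ) : ℤ) * (o i : ℤ))) u.1 v.1) ν
            *ᵥ (greenA d F (e / ((ℓ + 1) ^ k : ℕ)) ℓ k a m2 Ms (baseEmb hn Ms) (stairContour hn Ms)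
              (fun u v : ↥(Box d ℓ k Ms) =>
                compField (fun w => Ac (w + fun i => (((ℓ + 1) ^ k : ℕ) : ℤ) * (o i : ℤ))) u.1 v.1) *ᵥ f)) (x, i)|
            ≤ C * Real.exp (-(D / K)) * φ) ∧
      -- (1.9) on `Ω`, all pairs
      (∀ (ν : Fin (d + 1)) (x x' : ↥(Box d ℓ k Ms)), x.1 + e1 ν ∈ Box d ℓ k Ms → x'.1 + e1 ν ∈ Box d ℓ k Ms →
        x'.1 ≠ x.1 → ∀ (l : List ↥(Box d ℓ k Ms)), IsNNChain x l → pathEnd x l = x' →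
        (l.length : ℝ) ≤ ((d : ℝ) + 1) * supNorm (x'.1 - x.1) →
        (∀ z ∈ l, supNorm (z.1 - x.1) ≤ supNorm (x'.1 - x.1)) →
        ∀ (P : ↥(Box d ℓ k Ms) → Prop) [DecidablePred P] (D : ℝ), 0 ≤ D →
        (∀ x'', P x'' → ∃ μ, D ≤ |posR ℓ k Ms x μ - posR ℓ k Ms x'' μ|) →
        (∀ x'', P x'' → ∃ μ, D ≤ |posR ℓ k Ms x' μ - posR ℓ k Ms x'' μ|) →
        ∀ (f : ↥(Box d ℓ k Ms) × ι → ℝ), (∀ p, ¬ P p.1 → f p = 0) → ∀ (φ : ℝ), 0 ≤ φ → (∀ p, |f p| ≤ φ) →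
        ∀ i : ι,
          ((((ℓ + 1) ^ k : ℕ) : ℝ) / supNorm (x'.1 - x.1)) ^ α *
            |(transport (fieldLink F (e / ((ℓ + 1) ^ k : ℕ))
                  (fun u v : ↥(Box d ℓ k Ms) =>
                    compField (fun w => Ac (w + fun i => (((ℓ + 1) ^ k : ℕ) : ℤ) * (o i : ℤ))) u.1 v.1)) x l
                *ᵥ fld (derivA d F (e / ((ℓ + 1) ^ k : ℕ)) ℓ k Ms
                    (fun u v : ↥(Box d ℓ k Ms) =>
                      compField (fun w => Ac (w + fun i => (((ℓ + 1) ^ k : ℕ) : ℤ) * (o i : ℤ))) u.1 v.1) ν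
                  *ᵥ (greenA d F (e / ((ℓ + 1) ^ k : ℕ)) ℓ k a m2 Ms (baseEmb hn Ms) (stairContour hn Ms)
                    (fun u v : ↥(Box d ℓ k Ms) =>
                      compField (fun w => Ac (w + fun i => (((ℓ + 1) ^ k : ℕ) : ℤ) * (o i : ℤ))) u.1 v.1) *ᵥ f)) x'
              - fld (derivA d F (e / ((ℓ + 1) ^ k : ℕ)) ℓ k Ms
                    (fun u v : ↥(Box d ℓ k Ms) =>
                      compField (fun w => Ac (w + fun i => (((ℓ + 1) ^ k : ℕ) : ℤ) * (o i : ℤ))) u.1 v.1) ν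
                  *ᵥ (greenA d F (e / ((ℓ + 1) ^ k : ℕ)) ℓ k a m2 Ms (baseEmb hn Ms) (stairContour hn Ms)
                    (fun u v : ↥(Box d ℓ k Ms) =>
                      compField (fun w => Ac (w + fun i => (((ℓ + 1) ^ k : ℕ) : ℤ) * (o i : ℤ))) u.1 v.1) *ᵥ f)) x) i|
            ≤ C * Real.exp (-(D / K)) * φ) ∧
      -- `δG`, value
      (∀ (x : ↥(Box d ℓ k Ms)) (P : ↥(Box d ℓ k Ms) → Prop) [DecidablePred P] (D Db Df : ℝ),
        0 ≤ D → 0 ≤ Db → 0 ≤ Df →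
        (∀ x', P x' → ∃ μ, D ≤ |posR ℓ k Ms x μ - posR ℓ k Ms x' μ|) →
        (∀ y : ↥(Box d ℓ k Mb), ¬ inSub ℓ k Mb Ms o y →
          ∃ μ, Db ≤ |posR ℓ k Mb (subEmb ℓ k Mb Ms o ho x) μ - posR ℓ k Mb y μ|) →
        (∀ x', P x' → ∀ y : ↥(Box d ℓ k Mb), ¬ inSub ℓ k Mb Ms o y →
          ∃ μ, Df ≤ |posR ℓ k Mb (subEmb ℓ k Mb Ms o ho x') μ - posR ℓ k Mb y μ|) →
        ∀ (f : ↥(Box d ℓ k Ms) × ι → ℝ), (∀ p, ¬ P p.1 → f p = 0) → ∀ (φ : ℝ), 0 ≤ φ → (∀ p, |f p| ≤ φ) →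
        ∀ i : ι,
          |(greenA d F (e / ((ℓ + 1) ^ k : ℕ)) ℓ k a m2 Ms (baseEmb hn Ms) (stairContour hn Ms)
                (fun u v : ↥(Box d ℓ k Ms) =>
                  compField (fun w => Ac (w + fun i => (((ℓ + 1) ^ k : ℕ) : ℤ) * (o i : ℤ))) u.1 v.1) *ᵥ f) (x, i)
            - (greenA d F (e / ((ℓ + 1) ^ k : ℕ)) ℓ k a m2 Mb (baseEmb hn Mb) (stairContour hn Mb)
                (fun u v : ↥(Box d ℓ k Mb) => compField Ac u.1 v.1) *ᵥ extV ℓ k Mb Ms o f)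
                (subEmb ℓ k Mb Ms o ho x, i)|
            ≤ C * Real.exp (-((D + Db + Df) / (2 * K))) * φ) ∧
      -- `δG`, derivative
      (∀ (ν : Fin (d + 1)) (x : ↥(Box d ℓ k Ms)), x.1 + e1 ν ∈ Box d ℓ k Ms →
        ∀ (P : ↥(Box d ℓ k Ms) → Prop) [DecidablePred P] (D Db Df : ℝ),
        0 ≤ D → 0 ≤ Db → 0 ≤ Df →
        (∀ x', P x' → ∃ μ, D ≤ |posR ℓ k Ms x μ - posR ℓ k Ms x' μ|) →
        (∀ y : ↥(Box d ℓ k Mb), ¬ inSub ℓ k Mb Ms o y →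
          ∃ μ, Db ≤ |posR ℓ k Mb (subEmb ℓ k Mb Ms o ho x) μ - posR ℓ k Mb y μ|) →
        (∀ x', P x' → ∀ y : ↥(Box d ℓ k Mb), ¬ inSub ℓ k Mb Ms o y →
          ∃ μ, Df ≤ |posR ℓ k Mb (subEmb ℓ k Mb Ms o ho x') μ - posR ℓ k Mb y μ|) →
        ∀ (f : ↥(Box d ℓ k Ms) × ι → ℝ), (∀ p, ¬ P p.1 → f p = 0) → ∀ (φ : ℝ), 0 ≤ φ → (∀ p, |f p| ≤ φ) →
        ∀ i : ι,
          |(derivA d F (e / ((ℓ + 1) ^ k : ℕ)) ℓ k Ms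
                (fun u v : ↥(Box d ℓ k Ms) =>
                  compField (fun w => Ac (w + fun i => (((ℓ + 1) ^ k : ℕ) : ℤ) * (o i : ℤ))) u.1 v.1) ν
              *ᵥ (greenA d F (e / ((ℓ + 1) ^ k : ℕ)) ℓ k a m2 Ms (baseEmb hn Ms) (stairContour hn Ms)
                (fun u v : ↥(Box d ℓ k Ms) =>
                  compField (fun w => Ac (w + fun i => (((ℓ + 1) ^ k : ℕ) : ℤ) * (o i : ℤ))) u.1 v.1) *ᵥ f)) (x, i)
            - (derivA d F (e / ((ℓ + 1) ^ k : ℕ)) ℓ k Mb (fun u v : ↥(Box d ℓ k Mb) => compField Ac u.1 v.1) ν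
              *ᵥ (greenA d F (e / ((ℓ + 1) ^ k : ℕ)) ℓ k a m2 Mb (baseEmb hn Mb) (stairContour hn Mb)
                (fun u v : ↥(Box d ℓ k Mb) => compField Ac u.1 v.1) *ᵥ extV ℓ k Mb Ms o f))
                (subEmb ℓ k Mb Ms o ho x, i)|
            ≤ C * Real.exp (-((D + Db + Df) / (2 * K))) * φ) ∧
      -- `δG`, Hölder
      (∀ (ν : Fin (d + 1)) (x x' : ↥(Box d ℓ k Ms)), x.1 + e1 ν ∈ Box d ℓ k Ms → x'.1 + e1 ν ∈ Box d ℓ k Ms →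
        x'.1 ≠ x.1 → ∀ (l : List ↥(Box d ℓ k Ms)), IsNNChain x l → pathEnd x l = x' →
        (l.length : ℝ) ≤ ((d : ℝ) + 1) * supNorm (x'.1 - x.1) →
        (∀ z ∈ l, supNorm (z.1 - x.1) ≤ supNorm (x'.1 - x.1)) →
        ∀ (P : ↥(Box d ℓ k Ms) → Prop) [DecidablePred P] (D Db Df : ℝ), 0 ≤ D → 0 ≤ Db → 0 ≤ Df →
        (∀ x'', P x'' → ∃ μ, D ≤ |posR ℓ k Ms x μ - posR ℓ k Ms x'' μ|) →
        (∀ x'', P x'' → ∃ μ, D ≤ |posR ℓ k Ms x' μ - posR ℓ k Ms x'' μ|) →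
        (∀ y : ↥(Box d ℓ k Mb), ¬ inSub ℓ k Mb Ms o y →
          ∃ μ, Db ≤ |posR ℓ k Mb (subEmb ℓ k Mb Ms o ho x) μ - posR ℓ k Mb y μ|) →
        (∀ y : ↥(Box d ℓ k Mb), ¬ inSub ℓ k Mb Ms o y →
          ∃ μ, Db ≤ |posR ℓ k Mb (subEmb ℓ k Mb Ms o ho x') μ - posR ℓ k Mb y μ|) →
        (∀ x'', P x'' → ∀ y : ↥(Box d ℓ k Mb), ¬ inSub ℓ k Mb Ms o y →
          ∃ μ, Df ≤ |posR ℓ k Mb (subEmb ℓ k Mb Ms o ho x'') μ - posR ℓ k Mb y μ|) →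
        ∀ (f : ↥(Box d ℓ k Ms) × ι → ℝ), (∀ p, ¬ P p.1 → f p = 0) → ∀ (φ : ℝ), 0 ≤ φ → (∀ p, |f p| ≤ φ) →
        ∀ i : ι,
          ((((ℓ + 1) ^ k : ℕ) : ℝ) / supNorm (x'.1 - x.1)) ^ α *
            |(transport (fieldLink F (e / ((ℓ + 1) ^ k : ℕ))
                  (fun u v : ↥(Box d ℓ k Ms) =>
                    compField (fun w => Ac (w + fun i => (((ℓ + 1) ^ k : ℕ) : ℤ) * (o i : ℤ))) u.1 v.1)) x l
                *ᵥ fld (derivA d F (e / ((ℓ + 1) ^ k : ℕ)) ℓ k Ms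
                    (fun u v : ↥(Box d ℓ k Ms) =>
                      compField (fun w => Ac (w + fun i => (((ℓ + 1) ^ k : ℕ) : ℤ) * (o i : ℤ))) u.1 v.1) ν
                  *ᵥ (greenA d F (e / ((ℓ + 1) ^ k : ℕ)) ℓ k a m2 Ms (baseEmb hn Ms) (stairContour hn Ms)
                        (fun u v : ↥(Box d ℓ k Ms) =>
                          compField (fun w => Ac (w + fun i => (((ℓ + 1) ^ k : ℕ) : ℤ) * (o i : ℤ))) u.1 v.1) *ᵥ f
                      - restrV ℓ k Mb Ms o ho
                        (greenA d F (e / ((ℓ + 1) ^ k : ℕ)) ℓ k a m2 Mb (baseEmb hn Mb) (stairContour hn Mb)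
                          (fun u v : ↥(Box d ℓ k Mb) => compField Ac u.1 v.1) *ᵥ extV ℓ k Mb Ms o f))) x'
              - fld (derivA d F (e / ((ℓ + 1) ^ k : ℕ)) ℓ k Ms
                    (fun u v : ↥(Box d ℓ k Ms) =>
                      compField (fun w => Ac (w + fun i => (((ℓ + 1) ^ k : ℕ) : ℤ) * (o i : ℤ))) u.1 v.1) ν
                  *ᵥ (greenA d F (e / ((ℓ + 1) ^ k : ℕ)) ℓ k a m2 Ms (baseEmb hn Ms) (stairContour hn Ms)
                        (fun u v : ↥(Box d ℓ k Ms) =>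
                          compField (fun w => Ac (w + fun i => (((ℓ + 1) ^ k : ℕ) : ℤ) * (o i : ℤ))) u.1 v.1) *ᵥ f
                      - restrV ℓ k Mb Ms o ho
                        (greenA d F (e / ((ℓ + 1) ^ k : ℕ)) ℓ k a m2 Mb (baseEmb hn Mb) (stairContour hn Mb)
                          (fun u v : ↥(Box d ℓ k Mb) => compField Ac u.1 v.1) *ᵥ extV ℓ k Mb Ms o f))) x) i|
            ≤ C * Real.exp (-((D + Db + Df) / (2 * K))) * φ) := by
  obtain ⟨K₁, hK₁, h4₁, c₁, hc₁, H₁⟩ := thm110_value_box_noCollar F hℓ₁ hLip d ℓ hd hℓ amin aplus m2plus ha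
  obtain ⟨K₂, hK₂, -, c₂, hc₂, H₂⟩ := thm110_deriv_box_noCollar F hℓ₁ hLip d ℓ hd hℓ amin aplus m2plus ha
  obtain ⟨K₃, hK₃, -, HU₃⟩ := thm19_holder_box_noCollar_all F hℓ₁ hLip d ℓ hd hℓ amin aplus m2plus ha
  obtain ⟨K₄, hK₄, -, c₄, hc₄, H₄⟩ := thm112_value_box_noCollar F hℓ₁ hLip d ℓ hd hℓ amin aplus m2plus ha
  obtain ⟨K₅, hK₅, -, c₅, hc₅, H₅⟩ := thm112_deriv_box_noCollar F hℓ₁ hLip d ℓ hd hℓ amin aplus m2plus ha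
  obtain ⟨K₆, hK₆, -, HU₆⟩ := thm112_holder_box_noCollar F hℓ₁ hLip d ℓ hd hℓ amin aplus m2plus ha
  have hK₁1 : 1 ≤ K₁ := le_trans (by norm_num) hK₁
  have hK₂1 : 1 ≤ K₂ := le_trans (by norm_num) hK₂
  have hK₃1 : 1 ≤ K₃ := le_trans (by norm_num) hK₃
  have hK₄1 : 1 ≤ K₄ := le_trans (by norm_num) hK₄
  have hK₅1 : 1 ≤ K₅ := le_trans (by norm_num) hK₅
  have hK₆1 : 1 ≤ K₆ := le_trans (by norm_num) hK₆
  set K : ℕ := K₁ * (K₂ * (K₃ * (K₄ * (K₅ * K₆)))) with hK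
  have hd₁ : K₁ ∣ K := Dvd.intro _ rfl
  have hd₂ : K₂ ∣ K := by rw [hK]; exact Dvd.dvd.mul_left (Dvd.intro _ rfl) _
  have hd₃ : K₃ ∣ K := by
    rw [hK]; exact Dvd.dvd.mul_left (Dvd.dvd.mul_left (Dvd.intro _ rfl) _) _
  have hd₄ : K₄ ∣ K := by
    rw [hK]; exact Dvd.dvd.mul_left (Dvd.dvd.mul_left (Dvd.dvd.mul_left (Dvd.intro _ rfl) _) _) _
  have hd₅ : K₅ ∣ K := by
    rw [hK]
    exact Dvd.dvd.mul_left (Dvd.dvd.mul_left (Dvd.dvd.mul_left (Dvd.dvd.mul_left (Dvd.intro _ rfl) _) _) _) _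
  have hd₆ : K₆ ∣ K := by
    rw [hK]
    exact Dvd.dvd.mul_left (Dvd.dvd.mul_left (Dvd.dvd.mul_left (Dvd.dvd.mul_left (Dvd.intro_left _ rfl) _) _) _) _
  have hKpos : 0 < K := by positivity
  have hle : ∀ K' : ℕ, K' ∣ K → K' ≤ K := fun K' h => Nat.le_of_dvd hKpos h
  have hK16 : 16 ≤ K := by
    have : 8 * 8 ≤ K₁ * K₂ := Nat.mul_le_mul hK₁ hK₂
    have h12 : K₁ * K₂ ∣ K := by rw [hK, ← mul_assoc]; exact Dvd.intro _ rfl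
    exact le_trans (by norm_num) (le_trans this (hle _ h12))
  have h4 : 4 ∣ K := h4₁.trans hd₁
  have hKr : (0 : ℝ) < K := by exact_mod_cast hKpos
  have hmono : ∀ K' : ℕ, 1 ≤ K' → K' ∣ K → ∀ {D' : ℝ}, 0 ≤ D' → Real.exp (-(D' / K')) ≤ Real.exp (-(D' / K)) := by
    intro K' hK'1 hK'K D' hD'
    have hK'r : (0 : ℝ) < K' := by exact_mod_cast hK'1
    exact Real.exp_le_exp.mpr (neg_le_neg (div_le_div_of_nonneg_left hD' hK'r (by exact_mod_cast hle K' hK'K)))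
  have hmono2 : ∀ K' : ℕ, 1 ≤ K' → K' ∣ K → ∀ {D' : ℝ}, 0 ≤ D' →
      Real.exp (-(D' / (2 * K'))) ≤ Real.exp (-(D' / (2 * K))) := by
    intro K' hK'1 hK'K D' hD'
    have hK'r : (0 : ℝ) < K' := by exact_mod_cast hK'1
    have : (2 : ℝ) * K' ≤ 2 * K := by
      have : (K' : ℝ) ≤ K := by exact_mod_cast hle K' hK'K
      linarith only [this]
    exact Real.exp_le_exp.mpr (neg_le_neg (div_le_div_of_nonneg_left hD' (by positivity) this))
  refine ⟨K, hK16, h4, fun α hα0 hα1 => ?_⟩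
  obtain ⟨c₃, hc₃, H₃⟩ := HU₃ α hα0 hα1
  obtain ⟨c₆, hc₆, H₆⟩ := HU₆ α hα0 hα1
  set C : ℝ := c₁ + c₂ + c₃ + c₄ + c₅ + c₆ with hC
  have hC0 : 0 < C := by positivity
  have hc₁C : c₁ ≤ C := by rw [hC]; linarith only [hc₂, hc₃, hc₄, hc₅, hc₆]
  have hc₂C : c₂ ≤ C := by rw [hC]; linarith only [hc₁, hc₃, hc₄, hc₅, hc₆]
  have hc₃C : c₃ ≤ C := by rw [hC]; linarith only [hc₁, hc₂, hc₄, hc₅, hc₆]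
  have hc₄C : c₄ ≤ C := by rw [hC]; linarith only [hc₁, hc₂, hc₃, hc₅, hc₆]
  have hc₅C : c₅ ≤ C := by rw [hC]; linarith only [hc₁, hc₂, hc₃, hc₄, hc₆]
  have hc₆C : c₆ ≤ C := by rw [hC]; linarith only [hc₁, hc₂, hc₃, hc₄, hc₅]
  refine ⟨C, hC0, fun creg β hcreg hβ => ?_⟩
  obtain ⟨e₁, he₁, H₁'⟩ := H₁ creg β hcreg hβ
  obtain ⟨e₂, he₂, H₂'⟩ := H₂ creg β hcreg hβ
  obtain ⟨e₃, he₃, H₃'⟩ := H₃ creg β hcreg hβ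
  obtain ⟨e₄, he₄, H₄'⟩ := H₄ creg β hcreg hβ
  obtain ⟨e₅, he₅, H₅'⟩ := H₅ creg β hcreg hβ
  obtain ⟨e₆, he₆, H₆'⟩ := H₆ creg β hcreg hβ
  set eM : ℝ := min (min e₁ (min e₂ e₃)) (min e₄ (min e₅ e₆)) with heM
  refine ⟨eM, by positivity, ?_⟩
  intro k hk hn a m2 ha1 ha2 hm1 hm2 Mb Ms o ho hMs hKMb hKMs Ac e he hle' h17
  have hl₁ : e ≤ e₁ := hle'.trans ((min_le_left _ _).trans (min_le_left _ _))
  have hl₂ : e ≤ e₂ := hle'.trans ((min_le_left _ _).trans ((min_le_right _ _).trans (min_le_left _ _)))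
  have hl₃ : e ≤ e₃ := hle'.trans ((min_le_left _ _).trans ((min_le_right _ _).trans (min_le_right _ _)))
  have hl₄ : e ≤ e₄ := hle'.trans ((min_le_right _ _).trans (min_le_left _ _))
  have hl₅ : e ≤ e₅ := hle'.trans ((min_le_right _ _).trans ((min_le_right _ _).trans (min_le_left _ _)))
  have hl₆ : e ≤ e₆ := hle'.trans ((min_le_right _ _).trans ((min_le_right _ _).trans (min_le_right _ _)))
  have hnr : (0 : ℝ) < (((ℓ + 1) ^ k : ℕ) : ℝ) := by exact_mod_cast hn
  -- the translated field of `Ω` is (1.7)-regular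
  set t : Fin (d + 1) → ℤ := fun i => (((ℓ + 1) ^ k : ℕ) : ℤ) * (o i : ℤ) with ht
  have hmemT : ∀ w ∈ Box d ℓ k Ms, w + t ∈ Box d ℓ k Mb := fun w hw =>
    B4SubBoxCarrier.shift_mem_Box ℓ k Mb Ms o ho ⟨w, hw⟩
  have h17' : ∀ w ∈ Box d ℓ k Ms, ∀ μ ν : Fin (d + 1),
      |(fun w => Ac (w + t)) (w + e1 μ) ν - (fun w => Ac (w + t)) w ν| ≤ creg * e ^ (β - 1) / ((ℓ + 1) ^ k : ℕ) := by
    intro w hw μ ν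
    have := h17 (w + t) (hmemT w hw) μ ν
    simp only
    rw [add_right_comm]
    exact this
  have hMb : ∀ i, 1 ≤ Mb i := fun i => le_trans (le_trans (hMs i) (Nat.le_add_left _ _)) (ho i)
  have V := H₁' k hk hn a m2 ha1 ha2 hm1 hm2 Ms hMs (fun μ => hd₁.trans (hKMs μ)) (fun w => Ac (w + t)) e he hl₁ h17'
  have Dm := H₂' k hk hn a m2 ha1 ha2 hm1 hm2 Ms hMs (fun μ => hd₂.trans (hKMs μ)) (fun w => Ac (w + t)) e he hl₂ h17'
  have Hm := H₃' k hk hn a m2 ha1 ha2 hm1 hm2 Ms hMs (fun μ => hd₃.trans (hKMs μ)) (fun w => Ac (w + t)) e he hl₃ h17'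
  have dV := H₄' k hk hn a m2 ha1 ha2 hm1 hm2 Mb Ms o ho hMs (fun μ => hd₄.trans (hKMb μ)) (fun μ => hd₄.trans (hKMs μ))
    Ac e he hl₄ h17
  have dD := H₅' k hk hn a m2 ha1 ha2 hm1 hm2 Mb Ms o ho hMs (fun μ => hd₅.trans (hKMb μ)) (fun μ => hd₅.trans (hKMs μ))
    Ac e he hl₅ h17
  have dH := H₆' k hk hn a m2 ha1 ha2 hm1 hm2 Mb Ms o ho hMs (fun μ => hd₆.trans (hKMb μ)) (fun μ => hd₆.trans (hKMs μ))
    Ac e he hl₆ h17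
  refine ⟨?_, ?_, ?_, ?_, ?_, ?_⟩
  · intro x P _ D hD0 hD f hfP φ hφ hf i
    exact (V x P D hD f hfP φ hφ hf i).trans (mul_le_mul_of_nonneg_right
      (mul_le_mul hc₁C (hmono K₁ hK₁1 hd₁ hD0) (Real.exp_pos _).le hC0.le) hφ)
  · intro ν x hx P _ D hD0 hD f hfP φ hφ hf i
    exact (Dm ν x hx P D hD f hfP φ hφ hf i).trans (mul_le_mul_of_nonneg_right
      (mul_le_mul hc₂C (hmono K₂ hK₂1 hd₂ hD0) (Real.exp_pos _).le hC0.le) hφ)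
  · intro ν x x' hx hx' hne l hl hlend hlen hlnear P _ D hD0 hD hD' f hfP φ hφ hf i
    exact (Hm ν x x' hx hx' hne l hl hlend hlen hlnear P D hD0 hD hD' f hfP φ hφ hf i).trans
      (mul_le_mul_of_nonneg_right (mul_le_mul hc₃C (hmono K₃ hK₃1 hd₃ hD0) (Real.exp_pos _).le hC0.le) hφ)
  · intro x P _ D Db Df hD0 hDb0 hDf0 hD hDb hDf f hfP φ hφ hf i
    exact (dV x P D Db Df hD0 hDb0 hDf0 hD hDb hDf f hfP φ hφ hf i).trans (mul_le_mul_of_nonneg_right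
      (mul_le_mul hc₄C (hmono2 K₄ hK₄1 hd₄ (by positivity)) (Real.exp_pos _).le hC0.le) hφ)
  · intro ν x hx P _ D Db Df hD0 hDb0 hDf0 hD hDb hDf f hfP φ hφ hf i
    exact (dD ν x hx P D Db Df hD0 hDb0 hDf0 hD hDb hDf f hfP φ hφ hf i).trans (mul_le_mul_of_nonneg_right
      (mul_le_mul hc₅C (hmono2 K₅ hK₅1 hd₅ (by positivity)) (Real.exp_pos _).le hC0.le) hφ)
  · intro ν x x' hx hx' hne l hl hlend hlen hlnear P _ D Db Df hD0 hDb0 hDf0 hD hD' hDb hDb' hDf f hfP φ hφ hf i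
    exact (dH ν x x' hx hx' hne l hl hlend hlen hlnear P D Db Df hD0 hDb0 hDf0 hD hD' hDb hDb' hDf f hfP φ hφ hf i).trans
      (mul_le_mul_of_nonneg_right (mul_le_mul hc₆C (hmono2 K₆ hK₆1 hd₆ (by positivity)) (Real.exp_pos _).le
        hC0.le) hφ)

/-! ## §2. The family of settings with `regular` := (1.7) only -/

/-- **THE FAMILY OF SETTINGS OF THE THEOREM ON NESTED PAIRS OF BOXES AT A (1.7)-REGULAR FIELD, `regular` := (1.7)
ONLY (no collar clause)**: the fields of b04's
`B4.EtaSetting` filled with the printed objects on `Ω` (see the module docstring for each reading); the parameters are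
the flow, the dimension, `ℓ` (`L = ℓ+1`), the windows, the (1.7) constants `(c, β)` and the large-cube modulus `K` of
the side condition `bigBlocks` (the only place `K` enters) — the family IS `B4ThmBoxPairEta.boxPairFam` with the
one field `regular` replaced (structure update; all other fields reused verbatim). [cite: Balaban1983RegularityDecay, (1.7) p.572 with Theorem (1.9)–(1.12) p.573] -/
def boxPairFamNC (F : OrthFlow ι) (d ℓ : ℕ) (amin aplus m2plus creg β : ℝ) (K : ℕ)
    (i : BoxPairInst d ℓ amin aplus m2plus) : EtaSetting :=
  { boxPairFam F d ℓ amin aplus m2plus creg β K i with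
    regular := ∀ x ∈ Box d ℓ i.k i.Mb, ∀ μ ν : Fin (d + 1),
      |i.Ac (x + e1 μ) ν - i.Ac x ν| ≤ creg * i.e ^ (β - 1) / ((ℓ + 1) ^ i.k : ℕ) }

/-- The collar-free side condition is WEAKER than p17's collared one: `(boxPairFam … K i).regular → (boxPairFamNC … K i).regular`
— so `thmPrintedNN_boxPairFamNC` below covers every instance that `B4ThmBoxPairEta.thmPrintedNN_boxPairFam` covers, and
all the instances with `A_c` NOT constant near `∂Ω₀`, `∂Ω`. [cite: Balaban1983RegularityDecay, (1.7) p.572 with Theorem p.573, dictionary] -/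
theorem regular_of_boxPairFam_regular (F : OrthFlow ι) (d ℓ : ℕ) (amin aplus m2plus creg β : ℝ) (K : ℕ)
    (i : BoxPairInst d ℓ amin aplus m2plus) (h : (boxPairFam F d ℓ amin aplus m2plus creg β K i).regular) :
    (boxPairFamNC F d ℓ amin aplus m2plus creg β K i).regular := by
  dsimp only [boxPairFamNC, boxPairFam] at h ⊢
  exact h.1

/-- All fields other than `regular` are those of `boxPairFam` (definitionally). [cite: Balaban1983RegularityDecay, Theorem p.573, dictionary] -/
theorem boxPairFamNC_bigBlocks (F : OrthFlow ι) (d ℓ : ℕ) (amin aplus m2plus creg β : ℝ) (K : ℕ)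
    (i : BoxPairInst d ℓ amin aplus m2plus) :
    (boxPairFamNC F d ℓ amin aplus m2plus creg β K i).bigBlocks = (boxPairFam F d ℓ amin aplus m2plus creg β K i).bigBlocks :=
  rfl

/-- THE LARGE-CUBE MODULUS `K` of the side conditions (the `K` of `box_pair_members_noCollar`; it does not depend on `α`).
[cite: Balaban1983RegularityDecay, p.575 «big cubes of size M₁», dictionary] -/
def KmodNC (F : OrthFlow ι) {ℓ₁ : ℝ} (hℓ₁ : 0 ≤ ℓ₁)
    (hLip : ∀ t (v : ι → ℝ), ((F.U t - 1) *ᵥ v) ⬝ᵥ ((F.U t - 1) *ᵥ v) ≤ (ℓ₁ * t) ^ 2 * (v ⬝ᵥ v))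
    (d ℓ : ℕ) (hd : 1 ≤ d) (hℓ : 1 ≤ ℓ) (amin aplus m2plus : ℝ) (ha : 0 < amin) : ℕ :=
  Classical.choose (box_pair_members_noCollar F hℓ₁ hLip d ℓ hd hℓ amin aplus m2plus ha)

/-- **NON-VACUITY**: for every modulus `K ≥ 1` and threshold `e₁ > 0` there are instances satisfying `regular`,
`bigBlocks` and `0 < e ≤ e₁` (e.g. `A_c = 0`, `Ω = Π[0,nK) ⊂ Ω₀ = Π[0,2nK)`).
[cite: Balaban1983RegularityDecay, Theorem p.573, dictionary] -/
theorem hypotheses_met_noCollar (F : OrthFlow ι) (d ℓ : ℕ) {amin aplus m2plus : ℝ} (hap : amin ≤ aplus) (hm : 0 ≤ m2plus)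
    (creg β : ℝ) (hcreg : 0 ≤ creg) (K : ℕ) (hK : 1 ≤ K) (e₁ : ℝ) (he₁ : 0 < e₁) :
    ∃ i : BoxPairInst d ℓ amin aplus m2plus,
      (boxPairFamNC F d ℓ amin aplus m2plus creg β K i).regular ∧ (boxPairFamNC F d ℓ amin aplus m2plus creg β K i).bigBlocks ∧
      0 < (boxPairFamNC F d ℓ amin aplus m2plus creg β K i).e ∧ (boxPairFamNC F d ℓ amin aplus m2plus creg β K i).e ≤ e₁ := by
  let i0 : BoxPairInst d ℓ amin aplus m2plus :=
    { k := 1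
      hk := le_rfl
      Mb := fun _ => 2 * K
      Ms := fun _ => K
      o := fun _ => 0
      ho := fun _ => by omega
      hMs := fun _ => hK
      a := amin
      m2 := 0
      ha1 := le_rfl
      ha2 := hap
      hm1 := le_rfl
      hm2 := hm
      Ac := fun _ _ => 0
      e := e₁ }
  refine ⟨i0, ?_, ?_, he₁, le_rfl⟩
  · intro x _ μ ν
    change |(0 : ℝ) - 0| ≤ creg * e₁ ^ (β - 1) / ((ℓ + 1) ^ 1 : ℕ)
    rw [sub_self, abs_zero]
    positivity
  · exact ⟨fun _ => Dvd.intro_left 2 rfl, fun _ => dvd_rfl⟩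

/-! ## §3. The Theorem on the family, no collar -/

/-- **THEOREM p. 573, (1.9)–(1.12), ON THE FAMILY OF NESTED PAIRS OF BOXES AT A (1.7)-REGULAR FIELD, IN THE TYPED
`η`-UNIFORM FORM `ThmPrintedNN`, NO COLLAR.**  For the family `boxPairFamNC` (modulus `K = KmodNC`): for every `0 ≤ α < 1` there are
`δ₀, c₀, R₀, e₁ > 0` such that for every instance whose field is (1.7)-regular on `Ω₀` (constants `(c,β)`) — NO collar
hypothesis —, whose boxes have unit sides multiples of `K`, and whose coupling is
`0 < e ≤ e₁`, the inequalities (1.9)–(1.10) hold for `G_k(Ω,A|Ω)` and (1.9)–(1.10) with the factor (1.12) hold for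
`δG_k(Ω,Ω₀,A)`, for ALL `x, x′ ∈ Ω` (`Ω` a rectangular parallelepiped) — `Ineq19_110 ∧ Ineq111_112` at
`(α, δ₀, c₀, R₀)`, `δ₀ = (2K)⁻¹`.  The instance family of `B4ThmBoxPairEta.thmPrintedNN_boxPairFam` with the collar
clause of `regular` dropped (GAPS G-B4-p17-02 closed on boxes).
[cite: Balaban1983RegularityDecay, Theorem (1.9)–(1.12) p.573] -/
theorem thmPrintedNN_boxPairFamNC (F : OrthFlow ι) {ℓ₁ : ℝ} (hℓ₁ : 0 ≤ ℓ₁)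
    (hLip : ∀ t (v : ι → ℝ), ((F.U t - 1) *ᵥ v) ⬝ᵥ ((F.U t - 1) *ᵥ v) ≤ (ℓ₁ * t) ^ 2 * (v ⬝ᵥ v))
    (d ℓ : ℕ) (hd : 1 ≤ d) (hℓ : 1 ≤ ℓ) (amin aplus m2plus : ℝ) (ha : 0 < amin) (creg β : ℝ) (hcreg : 0 ≤ creg)
    (hβ : 0 < β) :
    ThmPrintedNN (boxPairFamNC F d ℓ amin aplus m2plus creg β (KmodNC F hℓ₁ hLip d ℓ hd hℓ amin aplus m2plus ha)) := by
  intro α hα0 hα1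
  classical
  obtain ⟨hK16, h4, HC⟩ := Classical.choose_spec (box_pair_members_noCollar F hℓ₁ hLip d ℓ hd hℓ amin aplus m2plus ha)
  set K : ℕ := KmodNC F hℓ₁ hLip d ℓ hd hℓ amin aplus m2plus ha with hKdef
  have hKeq : Classical.choose (box_pair_members_noCollar F hℓ₁ hLip d ℓ hd hℓ amin aplus m2plus ha) = K := rfl
  rw [hKeq] at hK16 h4 HC
  have hKr : (0 : ℝ) < K := by exact_mod_cast lt_of_lt_of_le (by norm_num) hK16
  obtain ⟨C, hC, HC'⟩ := HC α hα0 hα1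
  obtain ⟨e₁, he₁, H⟩ := HC' creg β hcreg hβ
  set N2 : ℝ := Real.sqrt (Fintype.card ι) with hN2
  have hN2 : 0 ≤ N2 := Real.sqrt_nonneg _
  set δ₀ : ℝ := 1 / (2 * K) with hδ₀
  have hδ₀0 : 0 < δ₀ := by positivity
  set c₀ : ℝ := N2 * C + 1 with hc₀
  have hc₀0 : 0 < c₀ := by positivity
  have hNC : N2 * C ≤ c₀ := by rw [hc₀]; linarith only
  refine ⟨δ₀, c₀, 1, e₁, hδ₀0, hc₀0, one_pos, he₁, ?_⟩
  intro i hreg hbig he hle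
  dsimp only [boxPairFamNC, boxPairFam] at hreg hbig he hle
  obtain ⟨hKMb, hKMs⟩ := hbig
  obtain ⟨V, Dm, Hm, dV, dD, dH⟩ := H i.k i.hk (Nat.one_le_pow i.k (ℓ + 1) (Nat.succ_pos ℓ)) i.a i.m2 i.ha1 i.ha2 i.hm1 i.hm2 i.Mb i.Ms i.o i.ho i.hMs hKMb hKMs
    i.Ac i.e he hle hreg
  have hnr : (0 : ℝ) < (((ℓ + 1) ^ i.k : ℕ) : ℝ) := by exact_mod_cast (Nat.one_le_pow i.k (ℓ + 1) (Nat.succ_pos ℓ))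
  -- the exponential conversions
  have hexp1 : ∀ {D : ℝ}, 0 ≤ D → Real.exp (-(D / K)) ≤ Real.exp (-(δ₀ * D)) := by
    intro D hD
    rw [Real.exp_le_exp, hδ₀]
    rw [show 1 / (2 * (K : ℝ)) * D = D / (2 * K) by ring]
    have : D / (2 * K) ≤ D / K := div_le_div_of_nonneg_left hD hKr (by linarith only [hKr])
    linarith only [this]
  have hexp2 : ∀ D Db Df : ℝ, Real.exp (-((D + Db + Df) / (2 * K))) = Real.exp (-(δ₀ * D)) * Real.exp (-(δ₀ * Db + δ₀ * Df)) := by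
    intro D Db Df
    rw [← Real.exp_add, hδ₀]
    congr 1
    field_simp
    ring
  -- sources: support, sup norm
  have hsrc : ∀ f : ↥(Box d ℓ i.k i.Ms) × ι → ℝ,
      (∀ p : ↥(Box d ℓ i.k i.Ms) × ι, ¬ (p.1 ∈ i.supp f) → f p = 0) ∧ 0 ≤ supN f ∧ (∀ p, |f p| ≤ supN f) :=
    fun f => ⟨fun p hp => i.eq_zero_of_not_mem_supp f p hp, supN_nonneg f, fun p => i.abs_le_supN f p⟩
  -- distances ↦ hypotheses of the members
  have hDs : ∀ (f : ↥(Box d ℓ i.k i.Ms) × ι → ℝ) (x : ↥(Box d ℓ i.k i.Ms)) (D : ℝ), D ≤ i.sdist1 x f →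
      ∀ x'', x'' ∈ i.supp f → ∃ μ, D ≤ |posR ℓ i.k i.Ms x μ - posR ℓ i.k i.Ms x'' μ| := by
    intro f x D hD x'' hx''
    refine exists_coord_of_le_supNorm ℓ i.k i.Ms x x'' ((mul_le_mul_of_nonneg_right hD hnr.le).trans ?_)
    exact i.sdist1_mul_le x f hx''
  have hDb : ∀ (x : ↥(Box d ℓ i.k i.Ms)) (Db : ℝ), Db ≤ i.bdist1 x → ∀ y : ↥(Box d ℓ i.k i.Mb),
      ¬ inSub ℓ i.k i.Mb i.Ms i.o y → ∃ μ, Db ≤ |posR ℓ i.k i.Mb (subEmb ℓ i.k i.Mb i.Ms i.o i.ho x) μ - posR ℓ i.k i.Mb y μ| := by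
    intro x Db hDb y hy
    refine exists_coord_of_le_supNorm ℓ i.k i.Mb _ y ((mul_le_mul_of_nonneg_right hDb hnr.le).trans ?_)
    exact i.bdist1_mul_le x hy
  have hDf : ∀ (f : ↥(Box d ℓ i.k i.Ms) × ι → ℝ), ∀ x'', x'' ∈ i.supp f → ∀ y : ↥(Box d ℓ i.k i.Mb),
      ¬ inSub ℓ i.k i.Mb i.Ms i.o y →
      ∃ μ, i.bdistS f ≤ |posR ℓ i.k i.Mb (subEmb ℓ i.k i.Mb i.Ms i.o i.ho x'') μ - posR ℓ i.k i.Mb y μ| :=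
    fun f x'' hx'' y hy => hDb x'' _ (i.bdistS_le f hx'') y hy
  -- vector bounds from component bounds
  have hvec : ∀ (v : ι → ℝ) {b : ℝ}, 0 ≤ b → (∀ j, |v j| ≤ C * b) → siteNorm v ≤ c₀ * b := by
    intro v b hb hv
    refine (siteNorm_le_sqrt_card_mul v (by positivity) hv).trans ?_
    rw [← mul_assoc]
    exact mul_le_mul_of_nonneg_right hNC hb
  have hvecw : ∀ (w : ℝ) (v : ι → ℝ) {b : ℝ}, 0 ≤ w → 0 ≤ b → (∀ j, w * |v j| ≤ C * b) → w * siteNorm v ≤ c₀ * b := by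
    intro w v b hw hb hv
    have : w * siteNorm v = siteNorm (w • v) := by rw [siteNorm_smul, abs_of_nonneg hw]
    rw [this]
    refine hvec (w • v) hb fun j => ?_
    rw [Pi.smul_apply, smul_eq_mul, abs_mul, abs_of_nonneg hw]
    exact hv j
  dsimp only [Ineq19_110, Ineq111_112, boxPairFamNC, boxPairFam]
  refine ⟨⟨?_, ?_⟩, ⟨?_, ?_⟩⟩
  ---------------------------------------------------------------- (1.9) on `Ω`
  · intro μ f x x' _
    obtain ⟨hfP, hφ, hf⟩ := hsrc f
    clear V Dm dV dD dH
    show i.holderQ F α μ (i.DΩ F μ *ᵥ (i.GΩ F *ᵥ f)) x x'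
      ≤ c₀ * Real.exp (-(δ₀ * min (i.sdist1 x f) (i.sdist1 x' f))) * supN f
    have hD0 : 0 ≤ min (i.sdist1 x f) (i.sdist1 x' f) := le_min (i.sdist1_nonneg x f) (i.sdist1_nonneg x' f)
    have hb0 : 0 ≤ Real.exp (-(δ₀ * min (i.sdist1 x f) (i.sdist1 x' f))) * supN f :=
      mul_nonneg (Real.exp_pos _).le hφ
    refine i.holderQ_le F (mul_nonneg (mul_nonneg hc₀0.le (Real.exp_pos _).le) hφ) fun l hl => ?_
    obtain ⟨hx, hx', hne, hch, hend, hlen, hnear⟩ := hl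
    have hw0 : 0 ≤ i.wt α x x' := Real.rpow_nonneg (div_nonneg hnr.le (supNorm_nonneg _)) α
    have := hvecw (i.wt α x x') _ hw0 hb0 fun j => by
      have h := Hm μ x x' hx hx' hne l hch hend hlen hnear (fun z => z ∈ i.supp f) _ hD0
        (hDs f x _ (min_le_left _ _)) (hDs f x' _ (min_le_right _ _)) f hfP (supN f) hφ hf j
      calc i.wt α x x' * |(transport (fieldLink F i.κ i.AΩ) x l *ᵥ fld (i.DΩ F μ *ᵥ (i.GΩ F *ᵥ f)) x'
              - fld (i.DΩ F μ *ᵥ (i.GΩ F *ᵥ f)) x) j|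
          ≤ C * Real.exp (-(min (i.sdist1 x f) (i.sdist1 x' f) / K)) * supN f := h
        _ ≤ C * (Real.exp (-(δ₀ * min (i.sdist1 x f) (i.sdist1 x' f))) * supN f) := by
            rw [mul_assoc]; exact mul_le_mul_of_nonneg_left (mul_le_mul_of_nonneg_right (hexp1 hD0) hφ) hC.le
    calc i.wt α x x' * siteNorm (transport (fieldLink F i.κ i.AΩ) x l *ᵥ fld (i.DΩ F μ *ᵥ (i.GΩ F *ᵥ f)) x'
            - fld (i.DΩ F μ *ᵥ (i.GΩ F *ᵥ f)) x)
        ≤ c₀ * (Real.exp (-(δ₀ * min (i.sdist1 x f) (i.sdist1 x' f))) * supN f) := this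
      _ = c₀ * Real.exp (-(δ₀ * min (i.sdist1 x f) (i.sdist1 x' f))) * supN f := by ring
  ---------------------------------------------------------------- (1.10) on `Ω`
  · intro μ f x _
    obtain ⟨hfP, hφ, hf⟩ := hsrc f
    clear Hm dV dD dH
    have hD0 : 0 ≤ i.sdist1 x f := i.sdist1_nonneg x f
    have hb0 : 0 ≤ Real.exp (-(δ₀ * i.sdist1 x f)) * supN f := mul_nonneg (Real.exp_pos _).le hφ
    have hR0 : 0 ≤ c₀ * Real.exp (-(δ₀ * i.sdist1 x f)) * supN f :=
      mul_nonneg (mul_nonneg hc₀0.le (Real.exp_pos _).le) hφ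
    refine ⟨?_, ?_⟩
    · show siteNorm (fld (i.DΩ F μ *ᵥ (i.GΩ F *ᵥ f)) x) ≤ c₀ * Real.exp (-(δ₀ * i.sdist1 x f)) * supN f
      by_cases hx : x.1 + e1 μ ∈ Box d ℓ i.k i.Ms
      · have := hvec (fld (i.DΩ F μ *ᵥ (i.GΩ F *ᵥ f)) x) hb0 fun j => by
          rw [fld_apply]
          have h := Dm μ x hx (fun z => z ∈ i.supp f) _ hD0 (hDs f x _ le_rfl) f hfP (supN f) hφ hf j
          calc |(i.DΩ F μ *ᵥ (i.GΩ F *ᵥ f)) (x, j)| ≤ C * Real.exp (-(i.sdist1 x f / K)) * supN f := h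
            _ ≤ C * (Real.exp (-(δ₀ * i.sdist1 x f)) * supN f) := by
                rw [mul_assoc]; exact mul_le_mul_of_nonneg_left (mul_le_mul_of_nonneg_right (hexp1 hD0) hφ) hC.le
        calc siteNorm (fld (i.DΩ F μ *ᵥ (i.GΩ F *ᵥ f)) x) ≤ c₀ * (Real.exp (-(δ₀ * i.sdist1 x f)) * supN f) := this
          _ = c₀ * Real.exp (-(δ₀ * i.sdist1 x f)) * supN f := by ring
      · rw [i.fld_DΩ_eq_zero F μ _ x hx, siteNorm_zero]
        exact hR0
    · show siteNorm (fld (i.GΩ F *ᵥ f) x) ≤ c₀ * Real.exp (-(δ₀ * i.sdist1 x f)) * supN f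
      have := hvec (fld (i.GΩ F *ᵥ f) x) hb0 fun j => by
        rw [fld_apply]
        have h := V x (fun z => z ∈ i.supp f) _ hD0 (hDs f x _ le_rfl) f hfP (supN f) hφ hf j
        calc |(i.GΩ F *ᵥ f) (x, j)| ≤ C * Real.exp (-(i.sdist1 x f / K)) * supN f := h
          _ ≤ C * (Real.exp (-(δ₀ * i.sdist1 x f)) * supN f) := by
              rw [mul_assoc]; exact mul_le_mul_of_nonneg_left (mul_le_mul_of_nonneg_right (hexp1 hD0) hφ) hC.le
      calc siteNorm (fld (i.GΩ F *ᵥ f) x) ≤ c₀ * (Real.exp (-(δ₀ * i.sdist1 x f)) * supN f) := this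
        _ = c₀ * Real.exp (-(δ₀ * i.sdist1 x f)) * supN f := by ring
  ---------------------------------------------------------------- (1.9)·(1.12) for `δG`
  · intro μ f x x' _
    obtain ⟨hfP, hφ, hf⟩ := hsrc f
    clear V Dm Hm dV dD
    show i.holderQ F α μ (i.DΩ F μ *ᵥ i.deltaV F f) x x'
      ≤ c₀ * Real.exp (-(δ₀ * min (i.sdist1 x f) (i.sdist1 x' f)))
        * Real.exp (-(δ₀ * min (i.bdist1 x) (i.bdist1 x') + δ₀ * i.bdistS f)) * supN f
    have hD0 : 0 ≤ min (i.sdist1 x f) (i.sdist1 x' f) := le_min (i.sdist1_nonneg x f) (i.sdist1_nonneg x' f)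
    have hDb0 : 0 ≤ min (i.bdist1 x) (i.bdist1 x') := le_min (i.bdist1_nonneg x) (i.bdist1_nonneg x')
    have hDf0 : 0 ≤ i.bdistS f := i.bdistS_nonneg f
    have hb0 : 0 ≤ Real.exp (-((min (i.sdist1 x f) (i.sdist1 x' f) + min (i.bdist1 x) (i.bdist1 x') + i.bdistS f)
        / (2 * K))) * supN f := mul_nonneg (Real.exp_pos _).le hφ
    rw [show c₀ * Real.exp (-(δ₀ * min (i.sdist1 x f) (i.sdist1 x' f)))
          * Real.exp (-(δ₀ * min (i.bdist1 x) (i.bdist1 x') + δ₀ * i.bdistS f)) * supN f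
        = c₀ * (Real.exp (-((min (i.sdist1 x f) (i.sdist1 x' f) + min (i.bdist1 x) (i.bdist1 x') + i.bdistS f)
          / (2 * K))) * supN f) by rw [hexp2]; ring]
    refine i.holderQ_le F (mul_nonneg hc₀0.le hb0) fun l hl => ?_
    obtain ⟨hx, hx', hne, hch, hend, hlen, hnear⟩ := hl
    have hw0 : 0 ≤ i.wt α x x' := Real.rpow_nonneg (div_nonneg hnr.le (supNorm_nonneg _)) α
    exact hvecw (i.wt α x x') _ hw0 hb0 fun j =>
      (dH μ x x' hx hx' hne l hch hend hlen hnear (fun z => z ∈ i.supp f) _ _ _ hD0 hDb0 hDf0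
        (hDs f x _ (min_le_left _ _)) (hDs f x' _ (min_le_right _ _)) (hDb x _ (min_le_left _ _))
        (hDb x' _ (min_le_right _ _)) (hDf f) f hfP (supN f) hφ hf j).trans (le_of_eq (mul_assoc _ _ _))
  ---------------------------------------------------------------- (1.10)·(1.12) for `δG`
  · intro μ f x _
    obtain ⟨hfP, hφ, hf⟩ := hsrc f
    clear V Dm Hm dH
    have hD0 : 0 ≤ i.sdist1 x f := i.sdist1_nonneg x f
    have hDb0 : 0 ≤ i.bdist1 x := i.bdist1_nonneg x
    have hDf0 : 0 ≤ i.bdistS f := i.bdistS_nonneg f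
    have hb0 : 0 ≤ Real.exp (-((i.sdist1 x f + i.bdist1 x + i.bdistS f) / (2 * K))) * supN f :=
      mul_nonneg (Real.exp_pos _).le hφ
    have hRHS : c₀ * Real.exp (-(δ₀ * i.sdist1 x f)) * Real.exp (-(δ₀ * i.bdist1 x + δ₀ * i.bdistS f)) * supN f
        = c₀ * (Real.exp (-((i.sdist1 x f + i.bdist1 x + i.bdistS f) / (2 * K))) * supN f) := by
      rw [hexp2]; ring
    refine ⟨?_, ?_⟩
    · show siteNorm (fld (i.DΩ F μ *ᵥ i.deltaV F f) x)
        ≤ c₀ * Real.exp (-(δ₀ * i.sdist1 x f)) * Real.exp (-(δ₀ * i.bdist1 x + δ₀ * i.bdistS f)) * supN f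
      rw [hRHS]
      by_cases hx : x.1 + e1 μ ∈ Box d ℓ i.k i.Ms
      · refine hvec _ hb0 fun j => ?_
        have h := dD μ x hx (fun z => z ∈ i.supp f) _ _ _ hD0 hDb0 hDf0 (hDs f x _ le_rfl) (hDb x _ le_rfl) (hDf f)
          f hfP (supN f) hφ hf j
        rw [i.fld_DΩ_deltaV_apply F μ f x hx j]
        exact h.trans (le_of_eq (mul_assoc _ _ _))
      · rw [i.fld_DΩ_eq_zero F μ _ x hx, siteNorm_zero]
        exact mul_nonneg hc₀0.le hb0
    · show siteNorm (fld (i.deltaV F f) x)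
        ≤ c₀ * Real.exp (-(δ₀ * i.sdist1 x f)) * Real.exp (-(δ₀ * i.bdist1 x + δ₀ * i.bdistS f)) * supN f
      rw [hRHS]
      refine hvec _ hb0 fun j => ?_
      have h := dV x (fun z => z ∈ i.supp f) _ _ _ hD0 hDb0 hDf0 (hDs f x _ le_rfl) (hDb x _ le_rfl) (hDf f)
        f hfP (supN f) hφ hf j
      rw [i.fld_deltaV_apply F f x j]
      exact h.trans (le_of_eq (mul_assoc _ _ _))

end

end Literature.MathematicalPhysics.QuantumFieldTheory.Balaban1983to89.B4ThmBoxPairEtaNoCollar
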